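import Literature.MathematicalPhysics.QuantumFieldTheory.Balaban1983to89.B12Moments443

/-!
# B12 §4 p.290 — extending the `y`-summations to the whole lattice: the tail estimate behind
«This gives again the exponentially small coefficients»

[cite: Balaban1987RG1 = T. Bałaban, *Renormalization group approach to lattice gauge field theories. I. Generation of
effective actions in a small field approximation and a coupling constant renormalization in four dimensions*,
Commun. Math. Phys. **109** (1987) 249–301; PDF page = journal page − 248.]

## CITATION HEADER (verbatim, journal p.290 = render `…1987-cmp109-rg-I-small-field-p042-x2.png`, read as an image)

After the table (4.34): «The sums over x above are restricted to supp δB ⊂ □, and the sums over y are restricted to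
supp B ⊂ supp ζ̃_□.»

The changes-and-resummations paragraph: «If we replace H_j(□₀) by H_j with free boundary conditions, then the
difference H_j(□₀) − H_j restricted to X × supp ζ̃_□, yields the factor B₀exp(−δ₀M(L^jη)^{−1}) in a bound of the
corresponding expression. Thus this change increases the sum of the irrelevant terms by the expression of the form
(4.34), but with very small coefficients. Next, we extend summations over y to the whole lattice Z⁴. The difference
between the sum over supp ζ̃_□ and the sum over Z⁴ is a sum over a subset of (□̃³)ᶜ∩Z⁴. This gives again the
exponentially small coefficients.»

(The kernels summed against `y` at this point are exponentially decaying in `|x − y|`: (4.36) p.290 «… ≤ O(1)E₀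
exp(−(L^jη)^{−1}) exp(−δ₁|x − y|), for x ∈ □», and, after (4.37), the vacuum polarization tensor obeys (5.10) p.293,
typed by this lineage as `B12Sec2to5.Decay510 Π C₁ δ₁` = `|Π(x)| ≤ C₁e^{−δ₁|x|₁}`.)

## WHAT IS TYPED HERE (the MECHANISM of the sentence, as [folklore] analysis on `ℤ^d`; nothing printed is asserted)

For a lattice kernel `c : ℤ^d → ℂ` with `|c(z)| ≤ M e^{−a|z|₁}` (`PeriodicGleason.ExpBound a M c`, `a > 0`) and a
weight `F` of polynomial growth `‖F(z)‖ ≤ K·pw_p(z)` (`pw_p(z) = Π_j(|z_j|+1)^p`; the moment weights `1`, `z_κ`,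
`z_κz_λ` of §4 have `K = 1`, `p = 0, 1, 2`):

* §1 `wt_le_exp_mul_wt_half`: on the tail `{R ≤ |z|₁}` half of the decay rate pays for the radius,
  `e^{−a|z|₁} ≤ e^{−(a/2)R}·e^{−(a/2)|z|₁}`; `S a p d = Σ_{z∈ℤ^d} e^{−a|z|₁}pw_p(z)` is the uniform constant
  (finite for `a > 0`: `PeriodicGleason.summable_wt_pw`).
* §2 `norm_tsum_compl_le`: `‖Σ_{z ∉ s} c(z)F(z)‖ ≤ M·K·e^{−(a/2)R}·S_{a/2,p,d}` for every finite `s ⊇ {z : |z|₁ < R}`;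
  `norm_tsum_sub_sum_le`: the same bound for `‖Σ_{z∈ℤ^d} c(z)F(z) − Σ_{z∈s} c(z)F(z)‖` — the difference between the sum
  over the whole lattice and the sum over the finite set IS the sum over the complement («is a sum over a subset of
  (□̃³)ᶜ∩Z⁴»), and it is exponentially small in the radius («exponentially small coefficients»).
* §3 `norm_tsum_sub_sum_shift_le`: the same in the paper's variables, kernel `c(x − y)` summed over `y`, finite set
  `Y ⊇ {y : |x − y|₁ < R}` (change of variables `y = x − z`, as in `B12Moments443`).
* §4 the three moment series of `B12Moments443` (`M0x`, `M1x`, `M2x` = `Σ_y Π_{μν}(x − y)`, `Σ_y Π_{μν}(x − y)(y_κ − x_κ)`,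
  `Σ_y Π_{μν}(x − y)(y_κ − x_κ)(y_λ − x_λ)` over the whole lattice) differ from their truncations to any finite
  `Y ⊇ {y : |x − y|₁ < R}` by at most `M·e^{−(a/2)R}·S_{a/2,p,d}`, `p = 0, 1, 2` (`M0x_sub_sum_le`, `M1x_sub_sum_le`,
  `M2x_sub_sum_le`), and the same under the typed (5.10) with `M = C₁`, `a = δ₁` (`*_of_decay510`).
* §5 back to the RESTRICTED sums of (4.34): with `B12Moments443`'s whole-lattice identities from the printed
  symmetries ((5.6) `PermCovariant`, (5.7) `ReflCovariant`, (5.9)₁ `WardFirst`, (5.10) `Decay510`, via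
  `B12Transverse536.taylorData3_of_symmetries`, `β = B12Beta.secondMoment Π μ₀ν₀` = (5.42) = (1.22)), the sums over
  any finite `Y ⊇ {y : |x − y|₁ < R}` satisfy (4.43) and (4.45) UP TO the error `C₁e^{−(δ₁/2)R}S_{δ₁/2,p,d}`:
  `sum_moment2_sub_le_of_symmetries` (`‖Σ_{y∈Y}Π_{μν}(x − y)(y_κ − x_κ)(y_λ − x_λ) − β(δ_{μκ}δ_{νλ} + δ_{μλ}δ_{νκ} −
  2δ_{μν}δ_{κλ})‖ ≤ …`), `norm_sum_moment1_le_of_symmetries` (`‖Σ_{y∈Y}Π_{μν}(x − y)(y_κ − x_κ)‖ ≤ …`),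
  `norm_sum_moment0_le_of_symmetries`.

## DICTIONARY / DIVERGENCE

* `Z⁴`, `ξZ⁴` ↦ the unit lattice `ℤ^d = Pt d`, `d` arbitrary (lineage convention); `|x − y|` ↦ the ℓ¹ norm `l1`
  (lineage convention for (5.10); an ℓ¹ exponential bound is the weakest of the ℓ^q readings to ASSUME? — no: since
  `|z|₁ ≥ |z|_q`, `e^{−a|z|₁} ≤ e^{−a|z|_q}`, so the ℓ¹ hypothesis is the STRONGEST decay hypothesis and the ℓ¹-ball
  `{|z|₁ < R}` the SMALLEST ball; both choices follow `B12Sec2to5.Decay510` and are recorded, not resolved, here).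
* «the sum over supp ζ̃_□» ↦ the sum over an ARBITRARY finite set (`s`, resp. `Y`) containing an ℓ¹-ball of radius `R`
  about the `x` in question; in the paper `x ∈ □` and supp ζ̃_□ contains (roughly) `□̃³`, so `R` is of the order of the
  distance from `□` to `(□̃³)ᶜ` — the cubes, `ζ̃_□`, and that distance are NOT typed (R is a free parameter).
* «exponentially small coefficients» ↦ the explicit factor `e^{−(a/2)R}` times the uniform constant `M·K·S_{a/2,p,d}`;
  the rate `a/2` (not `a`) is the price of uniformity in the polynomial weight — the paper does not specify a rate here.
* The kernel bound `ExpBound a M c` is a HYPOTHESIS (for Π it is the typed (5.10), itself a hypothesis throughout the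
  lineage; for `E^{(2)}(X, x, y)` it would be (4.36)/(3.7)-type tree decay, not typed here).

## NOT TYPED / NOT CLAIMED

The first change of the paragraph (`H_j(□₀) → H_j`, the factor `B₀exp(−δ₀M(L^jη)^{−1})`); that the tail terms have
«the form (4.34)» (the bookkeeping of irrelevant terms and their coefficients' sizes in `L^jη`); (4.36) and the
extension over localization domains; anything about which kernel is summed at this point of §4 beyond its exponential
decay. This module is a kernel certificate of an elementary mechanism, NOT progress on any summit statement.
-/

namespace Literature.MathematicalPhysics.QuantumFieldTheory.Balaban1983to89.B12WholeLattice290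

open Literature.MathematicalPhysics.QuantumFieldTheory.GawedzkiKupiainen1985.PeriodicGleason
open Literature.MathematicalPhysics.QuantumFieldTheory.Balaban1983to89.B12Rep537
open Literature.MathematicalPhysics.QuantumFieldTheory.Balaban1983to89.B12Transverse536
open Literature.MathematicalPhysics.QuantumFieldTheory.Balaban1983to89.B12Form543
open Literature.MathematicalPhysics.QuantumFieldTheory.Balaban1983to89.B12Marginal444
open Literature.MathematicalPhysics.QuantumFieldTheory.Balaban1983to89.B12Moments443

variable {d : ℕ}

/-! ## §1 The tail weight and the uniform constant -/

/-- On the tail `{R ≤ |z|₁}` one half of the decay rate pays for the radius: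
`e^{−a|z|₁} ≤ e^{−(a/2)R}·e^{−(a/2)|z|₁}` for `0 ≤ a`. [folklore] -/
theorem wt_le_exp_mul_wt_half {a R : ℝ} (ha : 0 ≤ a) {z : Pt d} (hz : R ≤ l1 z) :
    wt a z ≤ Real.exp (-(a / 2) * R) * wt (a / 2) z := by
  rw [wt, wt, ← Real.exp_add, Real.exp_le_exp]
  have h : a / 2 * R ≤ a / 2 * l1 z := mul_le_mul_of_nonneg_left hz (by linarith)
  linarith

/-- The uniform constant `S_{a,p,d} = Σ_{z ∈ ℤ^d} e^{−a|z|₁} Π_j (|z_j| + 1)^p` (a convergent series for `a > 0`,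
`PeriodicGleason.summable_wt_pw`). [folklore] -/
noncomputable def S (a : ℝ) (p d : ℕ) : ℝ := ∑' z : Pt d, wt a z * pw p z

/-- `0 ≤ S_{a,p,d}`. [folklore] -/
theorem S_nonneg (a : ℝ) (p d : ℕ) : 0 ≤ S a p d :=
  tsum_nonneg fun z => mul_nonneg (wt_pos a z).le (pw_pos p z).le

/-- The series defining `S_{a,p,d}` converges for `a > 0`. [folklore] -/
theorem hasSum_S {a : ℝ} (ha : 0 < a) (p d : ℕ) : HasSum (fun z : Pt d => wt a z * pw p z) (S a p d) :=
  (summable_wt_pw ha p d).hasSum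

/-! ## §2 The tail of an exponentially bounded kernel against a polynomial weight -/

/-- Pointwise bound on the tail `{R ≤ |z|₁}`: `‖c(z)F(z)‖ ≤ M·K·e^{−(a/2)R}·(e^{−(a/2)|z|₁}pw_p(z))`. [folklore] -/
theorem norm_term_le_of_le_l1 {a M : ℝ} (ha : 0 < a) {c : Pt d → ℂ} (hc : ExpBound a M c)
    {F : Pt d → ℂ} {K : ℝ} {p : ℕ} (hK : 0 ≤ K) (hF : ∀ n, ‖F n‖ ≤ K * pw p n)
    {R : ℝ} {z : Pt d} (hz : R ≤ l1 z) :
    ‖c z * F z‖ ≤ M * K * Real.exp (-(a / 2) * R) * (wt (a / 2) z * pw p z) := by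
  rw [norm_mul]
  have hM : 0 ≤ M := hc.nonneg
  calc ‖c z‖ * ‖F z‖ ≤ (M * wt a z) * (K * pw p z) :=
        mul_le_mul (hc z) (hF z) (norm_nonneg _) (mul_nonneg hM (wt_pos a z).le)
    _ ≤ (M * (Real.exp (-(a / 2) * R) * wt (a / 2) z)) * (K * pw p z) :=
        mul_le_mul_of_nonneg_right (mul_le_mul_of_nonneg_left (wt_le_exp_mul_wt_half ha.le hz) hM)
          (mul_nonneg hK (pw_pos p z).le)
    _ = M * K * Real.exp (-(a / 2) * R) * (wt (a / 2) z * pw p z) := by ring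

/-- **The tail estimate** (complement form): if the finite set `s` contains the ℓ¹-ball `{z : |z|₁ < R}`, then
`‖Σ_{z ∉ s} c(z)F(z)‖ ≤ M·K·e^{−(a/2)R}·S_{a/2,p,d}` («The difference … is a sum over a subset of (□̃³)ᶜ∩Z⁴. This gives
again the exponentially small coefficients.» p.290 — the mechanism, with the sets abstract). [folklore] -/
theorem norm_tsum_compl_le {a M : ℝ} (ha : 0 < a) {c : Pt d → ℂ} (hc : ExpBound a M c)
    {F : Pt d → ℂ} {K : ℝ} {p : ℕ} (hK : 0 ≤ K) (hF : ∀ n, ‖F n‖ ≤ K * pw p n)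
    (R : ℝ) (s : Finset (Pt d)) (hs : ∀ z, l1 z < R → z ∈ s) :
    ‖∑' z : ↑((↑s : Set (Pt d))ᶜ), c z * F z‖ ≤ M * K * Real.exp (-(a / 2) * R) * S (a / 2) p d := by
  set g : Pt d → ℝ := fun z => M * K * Real.exp (-(a / 2) * R) * (wt (a / 2) z * pw p z) with hg_def
  have hg : Summable g := (summable_wt_pw (half_pos ha) p d).mul_left _
  have hM : 0 ≤ M := hc.nonneg
  have hg0 : ∀ z, 0 ≤ g z := fun z =>
    mul_nonneg (mul_nonneg (mul_nonneg hM hK) (Real.exp_pos _).le) (mul_nonneg (wt_pos _ z).le (pw_pos p z).le)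
  have hle : ∀ z : ↑((↑s : Set (Pt d))ᶜ), ‖c z * F z‖ ≤ g z := fun z => by
    have hz : (z : Pt d) ∉ s := by
      have h2 := z.2
      rw [Set.mem_compl_iff, Finset.mem_coe] at h2
      exact h2
    exact norm_term_le_of_le_l1 ha hc hK hF (not_lt.mp fun h => hz (hs _ h))
  calc ‖∑' z : ↑((↑s : Set (Pt d))ᶜ), c z * F z‖ ≤ ∑' z : ↑((↑s : Set (Pt d))ᶜ), g z :=
        tsum_of_norm_bounded (hg.subtype _).hasSum hle
    _ ≤ ∑' z, g z := hg.tsum_subtype_le g _ hg0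
    _ = M * K * Real.exp (-(a / 2) * R) * S (a / 2) p d := by
        simp only [hg_def, tsum_mul_left, S]

/-- Under the same hypotheses the whole-lattice series converges (so the differences below are differences of sums).
[folklore] -/
theorem summable_mul {a M : ℝ} (ha : 0 < a) {c : Pt d → ℂ} (hc : ExpBound a M c)
    {F : Pt d → ℂ} {K : ℝ} {p : ℕ} (hF : ∀ n, ‖F n‖ ≤ K * pw p n) : Summable fun z => c z * F z :=
  hc.summable_mul ha hF

/-- **The tail estimate** (difference form): `Σ_{ℤ^d} − Σ_s = Σ_{sᶜ}` and hence
`‖Σ_{z∈ℤ^d} c(z)F(z) − Σ_{z∈s} c(z)F(z)‖ ≤ M·K·e^{−(a/2)R}·S_{a/2,p,d}` whenever `s ⊇ {z : |z|₁ < R}`. [folklore] -/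
theorem norm_tsum_sub_sum_le {a M : ℝ} (ha : 0 < a) {c : Pt d → ℂ} (hc : ExpBound a M c)
    {F : Pt d → ℂ} {K : ℝ} {p : ℕ} (hK : 0 ≤ K) (hF : ∀ n, ‖F n‖ ≤ K * pw p n)
    (R : ℝ) (s : Finset (Pt d)) (hs : ∀ z, l1 z < R → z ∈ s) :
    ‖∑' z, c z * F z - ∑ z ∈ s, c z * F z‖ ≤ M * K * Real.exp (-(a / 2) * R) * S (a / 2) p d := by
  have hsplit : ∑ z ∈ s, c z * F z + ∑' z : ↑((↑s : Set (Pt d))ᶜ), c z * F z = ∑' z, c z * F z := by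
    have h := (summable_mul ha hc hF).tsum_subtype_add_tsum_subtype_compl (↑s : Set (Pt d))
    rw [Finset.tsum_subtype' s (fun z => c z * F z)] at h
    exact h
  rw [← hsplit, add_sub_cancel_left]
  exact norm_tsum_compl_le ha hc hK hF R s hs

/-! ## §3 In the paper's variables: kernel `c(x − y)` summed over `y` -/

/-- Change of variables `y = x − z` in the finite sum: `Σ_{y∈Y} f(x − y) = Σ_{z ∈ x − Y} f(z)`. [folklore] -/
theorem sum_shift_eq (f : Pt d → ℂ) (x : Pt d) (Y : Finset (Pt d)) :
    ∑ y ∈ Y, f (x - y) = ∑ z ∈ Y.map (Equiv.subLeft x).toEmbedding, f z := by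
  rw [Finset.sum_map]
  simp only [Equiv.toEmbedding_apply, Equiv.subLeft_apply]

/-- Change of variables `y = x − z` in the series: `Σ_y f(x − y) = Σ_z f(z)`. [folklore] -/
theorem tsum_shift_eq (f : Pt d → ℂ) (x : Pt d) : ∑' y, f (x - y) = ∑' z, f z :=
  (Equiv.subLeft x).tsum_eq f

/-- If `Y` contains the ball `{y : |x − y|₁ < R}` then `x − Y` contains `{z : |z|₁ < R}`. [folklore] -/
theorem ball_subset_shift {x : Pt d} {R : ℝ} {Y : Finset (Pt d)} (hY : ∀ y, l1 (x - y) < R → y ∈ Y) :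
    ∀ z, l1 z < R → z ∈ Y.map (Equiv.subLeft x).toEmbedding := by
  intro z hz
  rw [Finset.mem_map]
  refine ⟨x - z, hY (x - z) (by rwa [sub_sub_cancel]), ?_⟩
  simp only [Equiv.toEmbedding_apply, Equiv.subLeft_apply, sub_sub_cancel]

/-- **The tail estimate in the paper's variables**: for `Y ⊇ {y : |x − y|₁ < R}` finite,
`‖Σ_{y∈ℤ^d} c(x − y)F(x − y) − Σ_{y∈Y} c(x − y)F(x − y)‖ ≤ M·K·e^{−(a/2)R}·S_{a/2,p,d}` («The difference between the
sum over supp ζ̃_□ and the sum over Z⁴ …» with supp ζ̃_□ ↦ `Y`). [folklore] -/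
theorem norm_tsum_sub_sum_shift_le {a M : ℝ} (ha : 0 < a) {c : Pt d → ℂ} (hc : ExpBound a M c)
    {F : Pt d → ℂ} {K : ℝ} {p : ℕ} (hK : 0 ≤ K) (hF : ∀ n, ‖F n‖ ≤ K * pw p n)
    (x : Pt d) (R : ℝ) (Y : Finset (Pt d)) (hY : ∀ y, l1 (x - y) < R → y ∈ Y) :
    ‖∑' y, c (x - y) * F (x - y) - ∑ y ∈ Y, c (x - y) * F (x - y)‖ ≤
      M * K * Real.exp (-(a / 2) * R) * S (a / 2) p d := by
  rw [tsum_shift_eq (fun z => c z * F z) x, sum_shift_eq (fun z => c z * F z) x Y]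
  exact norm_tsum_sub_sum_le ha hc hK hF R _ (ball_subset_shift hY)

/-! ## §4 The moment series of `B12Moments443` -/

/-- The weight `1`: `‖1‖ ≤ 1·pw_0`. [folklore] -/
theorem norm_one_le_pw (z : Pt d) : ‖(1 : ℂ)‖ ≤ 1 * pw 0 z := by simp

/-- The weight `−z_κ` (`= y_κ − x_κ` at `z = x − y`): `‖−z_κ‖ ≤ 1·pw_1(z)`. [folklore] -/
theorem norm_neg_coord_le_pw (κ : Fin d) (z : Pt d) : ‖-((z κ : ℤ) : ℂ)‖ ≤ 1 * pw 1 z := by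
  rw [norm_neg, ← monom_ind]
  exact norm_monom_le (ind κ) (fun j => by unfold ind; split_ifs <;> omega) z

/-- The weight `z_κz_λ` (`= (y_κ − x_κ)(y_λ − x_λ)` at `z = x − y`): `‖z_κz_λ‖ ≤ 1·pw_2(z)`. [folklore] -/
theorem norm_coord2_le_pw (κ l : Fin d) (z : Pt d) : ‖((z κ : ℤ) : ℂ) * ((z l : ℤ) : ℂ)‖ ≤ 1 * pw 2 z := by
  rw [← monom_pair]
  exact norm_monom_le _ (fun j => by split_ifs <;> omega) z

/-- **p.290 for the zeroth moments**: `‖Σ_{y∈ℤ^d} Π_{μν}(x − y) − Σ_{y∈Y} Π_{μν}(x − y)‖ ≤ M·e^{−(a/2)R}·S_{a/2,0,d}` for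
every finite `Y ⊇ {y : |x − y|₁ < R}`, under `|Π_{μν}(z)| ≤ Me^{−a|z|₁}`. [folklore] -/
theorem M0x_sub_sum_le {Pc : Fin d → Fin d → Pt d → ℂ} {a M : ℝ} (ha : 0 < a) (μ ν : Fin d)
    (hP : ExpBound a M (Pc μ ν)) (x : Pt d) (R : ℝ) (Y : Finset (Pt d)) (hY : ∀ y, l1 (x - y) < R → y ∈ Y) :
    ‖M0x Pc x μ ν - ∑ y ∈ Y, Pc μ ν (x - y)‖ ≤ M * Real.exp (-(a / 2) * R) * S (a / 2) 0 d := by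
  have h := norm_tsum_sub_sum_shift_le ha hP zero_le_one (fun z => norm_one_le_pw z) x R Y hY
  simp only [mul_one] at h
  simpa [M0x] using h

/-- **p.290 for the first moments**: `‖Σ_{y∈ℤ^d} Π_{μν}(x − y)(y_κ − x_κ) − Σ_{y∈Y} Π_{μν}(x − y)(y_κ − x_κ)‖ ≤
M·e^{−(a/2)R}·S_{a/2,1,d}` for every finite `Y ⊇ {y : |x − y|₁ < R}`. [folklore] -/
theorem M1x_sub_sum_le {Pc : Fin d → Fin d → Pt d → ℂ} {a M : ℝ} (ha : 0 < a) (μ ν κ : Fin d)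
    (hP : ExpBound a M (Pc μ ν)) (x : Pt d) (R : ℝ) (Y : Finset (Pt d)) (hY : ∀ y, l1 (x - y) < R → y ∈ Y) :
    ‖M1x Pc x μ ν κ - ∑ y ∈ Y, Pc μ ν (x - y) * ((y κ - x κ : ℤ) : ℂ)‖ ≤
      M * Real.exp (-(a / 2) * R) * S (a / 2) 1 d := by
  have h := norm_tsum_sub_sum_shift_le ha hP zero_le_one (fun z => norm_neg_coord_le_pw κ z) x R Y hY
  have e : ∀ y : Pt d, Pc μ ν (x - y) * -(((x - y) κ : ℤ) : ℂ) = Pc μ ν (x - y) * ((y κ - x κ : ℤ) : ℂ) := by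
    intro y; simp only [Pi.sub_apply, Int.cast_sub]; ring
  simp only [mul_one, e] at h
  simpa [M1x] using h

/-- **p.290 for the second moments** (the ones entering (4.43)): `‖Σ_{y∈ℤ^d} Π_{μν}(x − y)(y_κ − x_κ)(y_λ − x_λ) −
Σ_{y∈Y} Π_{μν}(x − y)(y_κ − x_κ)(y_λ − x_λ)‖ ≤ M·e^{−(a/2)R}·S_{a/2,2,d}` for every finite `Y ⊇ {y : |x − y|₁ < R}`.
[folklore] -/
theorem M2x_sub_sum_le {Pc : Fin d → Fin d → Pt d → ℂ} {a M : ℝ} (ha : 0 < a) (μ ν κ l : Fin d)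
    (hP : ExpBound a M (Pc μ ν)) (x : Pt d) (R : ℝ) (Y : Finset (Pt d)) (hY : ∀ y, l1 (x - y) < R → y ∈ Y) :
    ‖M2x Pc x μ ν κ l - ∑ y ∈ Y, Pc μ ν (x - y) * (((y κ - x κ : ℤ) : ℂ) * ((y l - x l : ℤ) : ℂ))‖ ≤
      M * Real.exp (-(a / 2) * R) * S (a / 2) 2 d := by
  have h := norm_tsum_sub_sum_shift_le ha hP zero_le_one (fun z => norm_coord2_le_pw κ l z) x R Y hY
  have e : ∀ y : Pt d, Pc μ ν (x - y) * ((((x - y) κ : ℤ) : ℂ) * (((x - y) l : ℤ) : ℂ)) =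
      Pc μ ν (x - y) * (((y κ - x κ : ℤ) : ℂ) * ((y l - x l : ℤ) : ℂ)) := by
    intro y; simp only [Pi.sub_apply, Int.cast_sub]; ring
  simp only [mul_one, e] at h
  simpa [M2x] using h

/-! ### Under the typed (5.10) -/

section Decay510

variable {P : B12Beta.Kernel d} {C₁ δ₁ : ℝ}

/-- p.290 for the zeroth moments of the real B12 kernel read in ℂ, under (5.10) `|Π_{μν}(x)| ≤ C₁e^{−δ₁|x|₁}`.
[cite: Balaban1987RG1, p.290 (y-extension) with (5.10) p.293] -/
theorem M0x_sub_sum_le_of_decay510 (hδ : 0 < δ₁) (h510 : ∀ μ ν, B12Sec2to5.Decay510 (P μ ν) C₁ δ₁)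
    (μ ν : Fin d) (x : Pt d) (R : ℝ) (Y : Finset (Pt d)) (hY : ∀ y, l1 (x - y) < R → y ∈ Y) :
    ‖M0x (ofRealK P) x μ ν - ∑ y ∈ Y, ofRealK P μ ν (x - y)‖ ≤
      C₁ * Real.exp (-(δ₁ / 2) * R) * S (δ₁ / 2) 0 d :=
  M0x_sub_sum_le hδ μ ν (expBound_of_decay510 (h510 μ ν)) x R Y hY

/-- p.290 for the first moments under (5.10). [cite: Balaban1987RG1, p.290 with (5.10) p.293] -/
theorem M1x_sub_sum_le_of_decay510 (hδ : 0 < δ₁) (h510 : ∀ μ ν, B12Sec2to5.Decay510 (P μ ν) C₁ δ₁)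
    (μ ν κ : Fin d) (x : Pt d) (R : ℝ) (Y : Finset (Pt d)) (hY : ∀ y, l1 (x - y) < R → y ∈ Y) :
    ‖M1x (ofRealK P) x μ ν κ - ∑ y ∈ Y, ofRealK P μ ν (x - y) * ((y κ - x κ : ℤ) : ℂ)‖ ≤
      C₁ * Real.exp (-(δ₁ / 2) * R) * S (δ₁ / 2) 1 d :=
  M1x_sub_sum_le hδ μ ν κ (expBound_of_decay510 (h510 μ ν)) x R Y hY

/-- p.290 for the second moments under (5.10): the whole-lattice left member of (4.43)-for-Π (`B12Moments443.M2x`)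
differs from its truncation to any finite `Y ⊇ {y : |x − y|₁ < R}` by at most `C₁e^{−(δ₁/2)R}S_{δ₁/2,2,d}`.
[cite: Balaban1987RG1, p.290 with (5.10) p.293] -/
theorem M2x_sub_sum_le_of_decay510 (hδ : 0 < δ₁) (h510 : ∀ μ ν, B12Sec2to5.Decay510 (P μ ν) C₁ δ₁)
    (μ ν κ l : Fin d) (x : Pt d) (R : ℝ) (Y : Finset (Pt d)) (hY : ∀ y, l1 (x - y) < R → y ∈ Y) :
    ‖M2x (ofRealK P) x μ ν κ l -
        ∑ y ∈ Y, ofRealK P μ ν (x - y) * (((y κ - x κ : ℤ) : ℂ) * ((y l - x l : ℤ) : ℂ))‖ ≤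
      C₁ * Real.exp (-(δ₁ / 2) * R) * S (δ₁ / 2) 2 d :=
  M2x_sub_sum_le hδ μ ν κ l (expBound_of_decay510 (h510 μ ν)) x R Y hY

end Decay510

/-! ## §5 Back to the restricted sums of (4.34): (4.43), (4.45) up to exponentially small coefficients

Combining §4 with `B12Moments443` (§4 there: (4.43), (4.45), `Σ_yΠ = 0` for the whole-lattice sums from the printed
symmetries (5.6), (5.7), (5.9)₁ and the decay (5.10)): the RESTRICTED moment sums — `y` over any finite
`Y ⊇ {y : |x − y|₁ < R}`, e.g. the paper's `supp ζ̃_□` — satisfy (4.43) and (4.45) up to an error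
`C₁e^{−(δ₁/2)R}S_{δ₁/2,p,d}`; this is the typed content of «This gives again the exponentially small coefficients»
for the moment identities used in the second and third terms of (4.34). -/

section Symmetries

variable {P : B12Beta.Kernel d} {C₁ δ₁ : ℝ} {μ₀ ν₀ : Fin d}

/-- **(4.43) for the restricted sums, up to an exponentially small error**:
`‖Σ_{y∈Y} Π_{μν}(x − y)(y_κ − x_κ)(y_λ − x_λ) − β(δ_{μκ}δ_{νλ} + δ_{μλ}δ_{νκ} − 2δ_{μν}δ_{κλ})‖ ≤ C₁e^{−(δ₁/2)R}S_{δ₁/2,2,d}`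
for every finite `Y ⊇ {y : |x − y|₁ < R}`, `β = B12Beta.secondMoment Π μ₀ ν₀` (= (5.42) = (1.22), any `μ₀ ≠ ν₀`), from
(5.6) `PermCovariant`, (5.7) `ReflCovariant`, (5.9)₁ `WardFirst`, (5.10) `Decay510`.
[cite: Balaban1987RG1, p.290 (y-extension); (4.43) p.291; (5.6)–(5.10) p.293; (5.42) p.297] -/
theorem sum_moment2_sub_le_of_symmetries (hδ : 0 < δ₁) (h510 : ∀ μ ν, B12Sec2to5.Decay510 (P μ ν) C₁ δ₁)
    (hperm : B12Beta.PermCovariant P) (hrefl : ReflCovariant P) (hward : WardFirst P) (h0 : μ₀ ≠ ν₀)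
    (μ ν κ l : Fin d) (x : Pt d) (R : ℝ) (Y : Finset (Pt d)) (hY : ∀ y, l1 (x - y) < R → y ∈ Y) :
    ‖∑ y ∈ Y, ofRealK P μ ν (x - y) * (((y κ - x κ : ℤ) : ℂ) * ((y l - x l : ℤ) : ℂ)) -
        ((B12Beta.secondMoment P μ₀ ν₀ : ℝ) : ℂ) *
          (kdA μ κ * kdA ν l + kdA μ l * kdA ν κ - 2 * kdA μ ν * kdA κ l)‖ ≤
      C₁ * Real.exp (-(δ₁ / 2) * R) * S (δ₁ / 2) 2 d := by
  rw [← moments443_of_symmetries hδ h510 hperm hrefl hward h0 x μ ν κ l, norm_sub_rev]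
  exact M2x_sub_sum_le_of_decay510 hδ h510 μ ν κ l x R Y hY

/-- **(4.45) for the restricted sums, up to an exponentially small error**:
`‖Σ_{y∈Y} Π_{μν}(x − y)(y_κ − x_κ)‖ ≤ C₁e^{−(δ₁/2)R}S_{δ₁/2,1,d}` for every finite `Y ⊇ {y : |x − y|₁ < R}`
(«hence this term vanishes» p.292 — up to the exponentially small coefficients of p.290).
[cite: Balaban1987RG1, p.290; (4.45) p.292; (5.6)–(5.10) p.293] -/
theorem norm_sum_moment1_le_of_symmetries (hδ : 0 < δ₁) (h510 : ∀ μ ν, B12Sec2to5.Decay510 (P μ ν) C₁ δ₁)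
    (hperm : B12Beta.PermCovariant P) (hrefl : ReflCovariant P) (hward : WardFirst P) (h0 : μ₀ ≠ ν₀)
    (μ ν κ : Fin d) (x : Pt d) (R : ℝ) (Y : Finset (Pt d)) (hY : ∀ y, l1 (x - y) < R → y ∈ Y) :
    ‖∑ y ∈ Y, ofRealK P μ ν (x - y) * ((y κ - x κ : ℤ) : ℂ)‖ ≤ C₁ * Real.exp (-(δ₁ / 2) * R) * S (δ₁ / 2) 1 d := by
  have h := M1x_sub_sum_le_of_decay510 hδ h510 μ ν κ x R Y hY
  rwa [moments445_of_symmetries hδ h510 hperm hrefl hward h0 x μ ν κ, zero_sub, norm_neg] at h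

/-- **No mass term for the restricted sums, up to an exponentially small error**:
`‖Σ_{y∈Y} Π_{μν}(x − y)‖ ≤ C₁e^{−(δ₁/2)R}S_{δ₁/2,0,d}` for every finite `Y ⊇ {y : |x − y|₁ < R}` (whole-lattice
value `Σ_yΠ_{μν} = Π̃_{μν}(0) = 0`, (5.16)). [cite: Balaban1987RG1, p.290; (5.16) p.293] -/
theorem norm_sum_moment0_le_of_symmetries (hδ : 0 < δ₁) (h510 : ∀ μ ν, B12Sec2to5.Decay510 (P μ ν) C₁ δ₁)
    (hperm : B12Beta.PermCovariant P) (hrefl : ReflCovariant P) (hward : WardFirst P) (h0 : μ₀ ≠ ν₀)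
    (μ ν : Fin d) (x : Pt d) (R : ℝ) (Y : Finset (Pt d)) (hY : ∀ y, l1 (x - y) < R → y ∈ Y) :
    ‖∑ y ∈ Y, ofRealK P μ ν (x - y)‖ ≤ C₁ * Real.exp (-(δ₁ / 2) * R) * S (δ₁ / 2) 0 d := by
  have h := M0x_sub_sum_le_of_decay510 hδ h510 μ ν x R Y hY
  rwa [moments0_of_symmetries hδ h510 hperm hrefl hward h0 x μ ν, zero_sub, norm_neg] at h

end Symmetries

end Literature.MathematicalPhysics.QuantumFieldTheory.Balaban1983to89.B12WholeLattice290
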